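import Mathlib
import HarnessLib
import Summits.CriticalPhenomena.PercolationContinuityZ3.Theses.PercLowPointHalfSpace
import Summits.CriticalPhenomena.PercolationContinuityZ3.Theorems.PercLowPointHalfSpaceLowPointBookkeepingOfSharpStubs

/-!
# The no-fat-half-box stub (B♯) dominates the route's crux B (`TallClusterMassBound`) up to `log r`

Helper file of line SketchIdeator1 (skeleton floor-russo) for the crux `LowPointBookkeeping`
(stmt-CriticalPhenomena-14713, route PercLowPointHalfSpace).  The line proves the crux from two
hypothesis-stubs, `stub_twoArmSharpFloor` (A♯ₛ) and `stub_noFatHalfBox` (B♯)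
(`FloorRusso.Glue.lowPointBookkeeping_of_sharp`), and `FloorRusso.Glue.boundaryTwoArmDecay_of_sharp`
records A♯ₛ ⇒ A.  This file records the companion fact for B:

* `sum_measureReal_inter_le` — counting lemma: `Σ_i P(A_i ∩ B) ≤ c P(B)` when at most `c` of the
  `A_i` occur simultaneously on `B`;
* `mass_le_of_tail` — if the mass `N_r = #{y ∈ B_r | 0 ↔_ℍ y}` of the half-space cluster of the
  origin has the exponential tail `P(N_r ≥ t M_r) ≤ e^{3/2} e^{-t/2}` (`t ≥ 1`), then
  `E[N_r ; arm_ℍ(0,r)] ≤ (2 log(15876 r⁵) M_r + e^{3/2}) P(arm_ℍ(0,r))`: truncate `N_r` at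
  `t₀ M_r`, `t₀ = 2 log(15876 r⁵)`, and absorb the tail `(2r+1)³ e^{3/2} e^{-t₀/2} ≤ e^{3/2}/(588 r²)`
  into the rigorous one-arm floor `P(arm_ℍ(0,r)) ≥ 1/(588 r²)` (`armH_lower_bound`, in tree);
* `tallClusterMassBound_log_of_noFatHalfBox` — **B♯ ⇒ B up to `log r`**: with the tail supplied by
  Hutchcroft's universal tightness from B♯ (`DilutionToolkit.tail`, landed),
  `Σ_{x ∈ B_r} P(0 ↔_ℍ x, arm_ℍ(0,r)) ≤ C r^{11/4} (1 + log r) P(arm_ℍ(0,r))` for all `r ≥ 1`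
  (registered wrapper `stub_sharpDominatesBLog`).

The continuation file `…SharpDominatesExp.lean` removes the logarithm for any exponent `m < 11/4`
(`TallClusterMassBound` by name).  So the two hypotheses of the line imply the route's A and B:
restating K's hypotheses as A♯ₛ, B♯ loses nothing of the route.  All probabilities of
`ℍ`-determined events agree under `P_{p_c}` and under the floor-diluted measure at `s = 1`
(`floorDilutedPercolation_one_apply_eq`).
-/


noncomputable section

open MeasureTheory Filter Topology
open Literature.Probability.Percolation Literature.Probability.LatticeModels
open scoped ENNReal Classical

namespace Summit.CriticalPhenomena.PercolationContinuityZ3.Theorems.FloorRusso.Dominates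

open Summit.CriticalPhenomena.PercolationContinuityZ3.Theses.PercLowPointHalfSpace
open Summit.CriticalPhenomena.PercolationContinuityZ3.Theorems.QuantitativeBGN.Negative
  (armH armH_lower_bound)

/-- The critical bond percolation measure on `ℤ³` (local notation). -/
local notation3 (prettyPrint := false) "μc" =>
  (bondPercolation (zdGraph 3) (criticalProbI 3) : Measure (BondConfig (Site 3)))

/-- The floor-diluted critical half-space measure at full floor density `s = 1` (local notation). -/
local notation3 (prettyPrint := false) "μ₁" =>
  (floorDilutedPercolation 3 (criticalProbI 3) 1 : Measure (BondConfig (Site 3)))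

/-- The closed half-space `ℍ = {x₀ ≥ 0}` (local notation). -/
local notation3 (prettyPrint := false) "HS" => ({x : Site 3 | 0 ≤ x 0} : Set (Site 3))

/-- The mass of the half-space cluster of the origin in `B_r`: `N_r(ω) = #{y ∈ B_r | 0 ↔_ℍ y}`,
as a real number (local notation). -/
local notation3 (prettyPrint := false) "𝑵⟦" r "," ω "⟧" =>
  ((((box 3 r).filter fun y : Site 3 => ω ∈ openConnIn HS (0 : Site 3) y).card : ℕ) : ℝ)

/-! ### A counting lemma: `Σ_i P(A_i ∩ B) ≤ c P(B)` when at most `c` of the `A_i` hold on `B` -/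

/-- If on the event `B` at most `c` of the events `A_i` (`i ∈ s`) occur simultaneously, then
`Σ_{i ∈ s} P(A_i ∩ B) ≤ c · P(B)` (the sum is the integral over `B` of the number of occurring
`A_i`). -/
theorem sum_measureReal_inter_le {Ω ι : Type*} [MeasurableSpace Ω] (μ : Measure Ω)
    [IsFiniteMeasure μ] (s : Finset ι) (A : ι → Set Ω) (B : Set Ω)
    (hA : ∀ i ∈ s, MeasurableSet (A i)) (hB : MeasurableSet B) {c : ℝ}
    (hcount : ∀ ω ∈ B, ((s.filter fun i => ω ∈ A i).card : ℝ) ≤ c) :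
    ∑ i ∈ s, μ.real (A i ∩ B) ≤ c * μ.real B := by
  have h1 : ∀ i ∈ s, μ.real (A i ∩ B) =
      ∫ ω, (A i ∩ B).indicator (fun _ => (1 : ℝ)) ω ∂μ := fun i hi => by
    rw [integral_indicator_const (1 : ℝ) ((hA i hi).inter hB), smul_eq_mul, mul_one]
  have h2 : c * μ.real B = ∫ ω, B.indicator (fun _ => c) ω ∂μ := by
    rw [integral_indicator_const c hB, smul_eq_mul, mul_comm]
  rw [Finset.sum_congr rfl h1, ← integral_finsetSum s fun i hi =>
    (integrable_const (1 : ℝ)).indicator ((hA i hi).inter hB), h2]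
  refine integral_mono_of_nonneg (Eventually.of_forall fun ω => Finset.sum_nonneg fun i _ =>
    Set.indicator_nonneg (fun _ _ => zero_le_one) _) ((integrable_const c).indicator hB)
    (Eventually.of_forall fun ω => ?_)
  by_cases hω : ω ∈ B
  · have : ∑ i ∈ s, (A i ∩ B).indicator (fun _ => (1 : ℝ)) ω =
        ((s.filter fun i => ω ∈ A i).card : ℝ) := by
      rw [Finset.card_filter]
      push_cast
      refine Finset.sum_congr rfl fun i _ => ?_
      by_cases hi : ω ∈ A i
      · rw [Set.indicator_of_mem (show ω ∈ A i ∩ B from ⟨hi, hω⟩), if_pos hi]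
      · rw [Set.indicator_of_notMem (show ω ∉ A i ∩ B from fun h => hi h.1), if_neg hi]
    simp only
    rw [this, Set.indicator_of_mem hω]
    exact hcount ω hω
  · have : ∑ i ∈ s, (A i ∩ B).indicator (fun _ => (1 : ℝ)) ω = 0 :=
      Finset.sum_eq_zero fun i _ => Set.indicator_of_notMem (fun h => hω h.2) _
    simp only
    rw [this, Set.indicator_of_notMem hω]

/-! ### The objects: mass of `C_ℍ(0)` in `B_r`, the arm event, transfer to `P_{p_c}` -/

/-- The mass `N_r` is a measurable function of the configuration. -/
theorem measurable_mass (r : ℕ) : Measurable fun ω : BondConfig (Site 3) => 𝑵⟦r, ω⟧ := by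
  have h : (fun ω : BondConfig (Site 3) => 𝑵⟦r, ω⟧) = fun ω => ∑ y ∈ box 3 r,
      (openConnIn HS (0 : Site 3) y : Set (BondConfig (Site 3))).indicator (fun _ => (1 : ℝ)) ω := by
    funext ω
    rw [Finset.card_filter]
    push_cast
    refine Finset.sum_congr rfl fun y _ => ?_
    by_cases hy : ω ∈ openConnIn HS (0 : Site 3) y
    · rw [if_pos hy, Set.indicator_of_mem hy]
    · rw [if_neg hy, Set.indicator_of_notMem hy]
  rw [h]
  exact Finset.measurable_sum _ fun y _ =>
    measurable_const.indicator (measurableSet_openConnIn_of_countable _ _ _)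

/-- The mass in the form produced by the dilution toolkit (`Set.ncard` of `B_r ∩ {y | 0 ↔_ℍ 0 + y}`)
is `N_r`. -/
theorem ncard_eq_mass (r : ℕ) (ω : BondConfig (Site 3)) :
    (((↑(box 3 r) : Set (Site 3)) ∩
        {y : Site 3 | ω ∈ openConnIn HS (0 : Site 3) ((0 : Site 3) + y)}).ncard : ℝ) = 𝑵⟦r, ω⟧ := by
  rw [← Set.ncard_coe_finset]
  congr 2
  ext y
  simp [zero_add]

/-- `P^{ℍ}_{p_c,1}` and `P_{p_c}` agree on `ℍ`-determined measurable events. -/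
theorem real_one_eq {A : Set (BondConfig (Site 3))} (hA : DeterminedBy A (Set.sym2 HS))
    (hAm : MeasurableSet A) : (μ₁).real A = (μc).real A := by
  simp only [measureReal_def]
  rw [floorDilutedPercolation_one_apply_eq (criticalProbI 3) hA hAm]

/-- The arm event `arm_ℍ(0,r)` has the same probability under both measures. -/
theorem real_one_armH (r : ℕ) : (μ₁).real (armH r) = (μc).real (armH r) :=
  real_one_eq (Glue.determinedBy_arm (fun y : Site 3 => ∃ i : Fin 3, ((r : ℕ) : ℤ) ≤ |y i|) 0)
    (Glue.measurableSet_arm (fun y : Site 3 => ∃ i : Fin 3, ((r : ℕ) : ℤ) ≤ |y i|) 0)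

/-- The joint events `{0 ↔_ℍ x} ∩ arm_ℍ(0,r)` have the same probability under both measures. -/
theorem real_one_conn_inter_armH (x : Site 3) (r : ℕ) :
    (μ₁).real (openConnIn HS 0 x ∩ armH r) = (μc).real (openConnIn HS 0 x ∩ armH r) :=
  real_one_eq
    ((DCT16.determinedBy_openConnIn HS 0 x subset_rfl).inter
      (Glue.determinedBy_arm (fun y : Site 3 => ∃ i : Fin 3, ((r : ℕ) : ℤ) ≤ |y i|) 0))
    ((measurableSet_openConnIn_of_countable _ _ _).inter
      (Glue.measurableSet_arm (fun y : Site 3 => ∃ i : Fin 3, ((r : ℕ) : ℤ) ≤ |y i|) 0))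


/-- `N_r ≤ |K_0 ∩ Λ_r|` for the half-box `Λ_r = B_r ∩ ℍ` (an `ℍ`-open path is open and ends in `ℍ`). -/
theorem mass_le_clusterCapIn (n : ℕ) (ω : BondConfig (Site 3)) :
    ((box 3 n).filter fun y : Site 3 => ω ∈ openConnIn HS (0 : Site 3) y).card ≤
      clusterCapIn ((box 3 n).filter fun z : Site 3 => 0 ≤ z 0) ω 0 := by
  have h := DilutionToolkit.ncard_le_clusterCapIn 0 n ω
  have himg : ((box 3 n).image fun y : Site 3 => (0 : Site 3) + y) = box 3 n := by
    simp only [zero_add, Finset.image_id']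
  have hN : ((↑(box 3 n) : Set (Site 3)) ∩
      {y : Site 3 | ω ∈ openConnIn HS (0 : Site 3) ((0 : Site 3) + y)}).ncard =
      ((box 3 n).filter fun y : Site 3 => ω ∈ openConnIn HS (0 : Site 3) y).card := by
    exact_mod_cast ncard_eq_mass n ω
  rw [himg, hN] at h
  exact h

/-! ### Truncation: an exponential tail for `N_r` makes the arm-conditioned mass `O(M_r log r)` -/

/-- `log 15876 ≤ 10` (`15876 = 27 · 588 ≤ 2.718…¹⁰ ≤ e¹⁰`). -/
theorem log_const_le : Real.log 15876 ≤ 10 := by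
  rw [Real.log_le_iff_le_exp (by norm_num)]
  have h := Real.exp_one_gt_d9
  have h10 : Real.exp (10 : ℝ) = Real.exp 1 ^ 10 := by
    rw [Real.exp_one_pow]; norm_num
  rw [h10]
  calc (15876 : ℝ) ≤ (2.7182818283 : ℝ) ^ 10 := by norm_num
    _ ≤ Real.exp 1 ^ 10 := pow_le_pow_left₀ (by norm_num) h.le 10

/-- `log (15876 r⁵) ≤ 10 + 5 log r` for `r ≥ 1`. -/
theorem log_scale_le {r : ℕ} (hr : 1 ≤ r) :
    Real.log (15876 * (r : ℝ) ^ 5) ≤ 10 + 5 * Real.log r := by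
  have hr0 : (0 : ℝ) < r := by exact_mod_cast hr
  rw [Real.log_mul (by norm_num) (by positivity), Real.log_pow]
  push_cast
  linarith [log_const_le]

/-- **Truncation lemma.**  If the mass `N_r` of `C_ℍ(0)` in `B_r` has the tail
`P(N_r ≥ t M) ≤ e^{3/2} e^{-t/2}` for all `t ≥ 1` (under `P^{ℍ}_{p_c,1}`), then
`Σ_{x ∈ B_r} P_{p_c}(0 ↔_ℍ x, arm_ℍ(0,r)) ≤ (2 log(15876 r⁵) M + e^{3/2}) P_{p_c}(arm_ℍ(0,r))`.
Proof: the sum is `E[N_r ; arm]`; on `{N_r < t₀ M}` it is at most `t₀ M P(arm)` (counting lemma);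
the rest is at most `(2r+1)³ P(N_r ≥ t₀ M) ≤ (2r+1)³ e^{3/2}/(15876 r⁵) ≤ e^{3/2}/(588 r²)` with
`t₀ = 2 log(15876 r⁵)`, and `1/(588 r²) ≤ P(arm_ℍ(0,r))` is the landed one-arm floor
`armH_lower_bound`. -/
theorem mass_le_of_tail {r : ℕ} (hr : 1 ≤ r) {M : ℝ} (hM : 0 < M)
    (htail : ∀ t : ℝ, 1 ≤ t →
      (μ₁).real {ω | t * M ≤ 𝑵⟦r, ω⟧} ≤ Real.exp (3 / 2) * Real.exp (-t / 2)) :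
    ∑ x ∈ box 3 r, (μc).real (openConnIn HS 0 x ∩ armH r) ≤
      (2 * Real.log (15876 * (r : ℝ) ^ 5) * M + Real.exp (3 / 2)) * (μc).real (armH r) := by
  obtain ⟨L, hL⟩ : ∃ L : ℝ, L = 15876 * (r : ℝ) ^ 5 := ⟨_, rfl⟩
  obtain ⟨t₀, ht₀⟩ : ∃ t₀ : ℝ, t₀ = 2 * Real.log L := ⟨_, rfl⟩
  have hr0 : (0 : ℝ) < r := by exact_mod_cast hr
  have hr1 : (1 : ℝ) ≤ r := by exact_mod_cast hr
  have hL1 : (15876 : ℝ) ≤ L := by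
    have : (1 : ℝ) ≤ (r : ℝ) ^ 5 := one_le_pow₀ hr1
    rw [hL]; nlinarith
  have hLpos : 0 < L := by linarith
  have hlogL : 1 ≤ Real.log L := by
    rw [Real.le_log_iff_exp_le hLpos]
    have := Real.exp_one_lt_d9
    linarith
  have ht₀1 : 1 ≤ t₀ := by rw [ht₀]; linarith
  have hexp : Real.exp (-t₀ / 2) = L⁻¹ := by
    rw [ht₀, show -(2 * Real.log L) / 2 = -Real.log L by ring, Real.exp_neg, Real.exp_log hLpos]
  -- the small-mass event `S = {N_r < t₀ M}`
  obtain ⟨S, hS⟩ : ∃ S : Set (BondConfig (Site 3)), S = {ω | 𝑵⟦r, ω⟧ < t₀ * M} := ⟨_, rfl⟩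
  have hSm : MeasurableSet S := hS ▸ measurableSet_lt (measurable_mass r) measurable_const
  have htailS : (μ₁).real Sᶜ ≤ Real.exp (3 / 2) * L⁻¹ := by
    have h := htail t₀ ht₀1
    rw [hexp] at h
    refine le_trans (le_of_eq ?_) h
    congr 1
    ext ω
    simp only [hS, Set.mem_compl_iff, Set.mem_setOf_eq, not_lt]
  -- transfer every probability to `P^{ℍ}_{p_c,1}`
  have hT : (μc).real (armH r) = (μ₁).real (armH r) := (real_one_armH r).symm
  rw [hT, Finset.sum_congr rfl fun x _ => (real_one_conn_inter_armH x r).symm]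
  -- split each term along `S`
  have hsplit : ∀ x ∈ box 3 r, (μ₁).real (openConnIn HS 0 x ∩ armH r) ≤
      (μ₁).real (openConnIn HS 0 x ∩ (armH r ∩ S)) + (μ₁).real Sᶜ := by
    intro x _
    rw [← measureReal_inter_add_sdiff (μ := μ₁) (s := openConnIn HS 0 x ∩ armH r) hSm,
      Set.inter_assoc]
    exact add_le_add le_rfl (measureReal_mono (fun ω hω => hω.2) (measure_ne_top _ _))
  -- counting lemma on `B = arm ∩ S`: at most `t₀ M` of the events `{0 ↔_ℍ x}` occur there
  have hcount : ∑ x ∈ box 3 r, (μ₁).real (openConnIn HS 0 x ∩ (armH r ∩ S)) ≤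
      t₀ * M * (μ₁).real (armH r ∩ S) := by
    refine sum_measureReal_inter_le (μ₁) (box 3 r)
      (fun x => (openConnIn HS (0 : Site 3) x : Set (BondConfig (Site 3)))) (armH r ∩ S)
      (fun x _ => measurableSet_openConnIn_of_countable _ _ _)
      ((Glue.measurableSet_arm _ 0).inter hSm) fun ω hω => ?_
    have h2 : ω ∈ S := hω.2
    rw [hS] at h2
    exact le_of_lt h2
  -- the one-arm floor and the size of the box
  have hbox : ((box 3 r).card : ℝ) = (2 * (r : ℝ) + 1) ^ 3 := by
    rw [card_box]; push_cast; ring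
  have harm : 1 / (588 * (r : ℝ) ^ 2) ≤ (μ₁).real (armH r) := by
    obtain ⟨n, rfl⟩ : ∃ n, r = n + 1 := ⟨r - 1, by omega⟩
    rw [← hT]
    have h := armH_lower_bound n
    push_cast at h ⊢
    exact h
  have hgeom : ((box 3 r).card : ℝ) * (Real.exp (3 / 2) * L⁻¹) ≤
      Real.exp (3 / 2) * (1 / (588 * (r : ℝ) ^ 2)) := by
    rw [hbox, hL]
    have h3 : (2 * (r : ℝ) + 1) ^ 3 ≤ (3 * (r : ℝ)) ^ 3 :=
      pow_le_pow_left₀ (by positivity) (by linarith) 3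
    have hfrac : (2 * (r : ℝ) + 1) ^ 3 / (15876 * (r : ℝ) ^ 5) ≤ 1 / (588 * (r : ℝ) ^ 2) := by
      rw [div_le_div_iff₀ (by positivity) (by positivity)]
      calc (2 * (r : ℝ) + 1) ^ 3 * (588 * (r : ℝ) ^ 2) ≤ (3 * (r : ℝ)) ^ 3 * (588 * (r : ℝ) ^ 2) := by
            gcongr
        _ = 1 * (15876 * (r : ℝ) ^ 5) := by ring
    calc (2 * (r : ℝ) + 1) ^ 3 * (Real.exp (3 / 2) * (15876 * (r : ℝ) ^ 5)⁻¹)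
        = Real.exp (3 / 2) * ((2 * (r : ℝ) + 1) ^ 3 / (15876 * (r : ℝ) ^ 5)) := by ring
      _ ≤ Real.exp (3 / 2) * (1 / (588 * (r : ℝ) ^ 2)) :=
          mul_le_mul_of_nonneg_left hfrac (Real.exp_pos _).le
  -- assemble
  calc ∑ x ∈ box 3 r, (μ₁).real (openConnIn HS 0 x ∩ armH r)
      ≤ ∑ x ∈ box 3 r, ((μ₁).real (openConnIn HS 0 x ∩ (armH r ∩ S)) + (μ₁).real Sᶜ) :=
        Finset.sum_le_sum hsplit
    _ = ∑ x ∈ box 3 r, (μ₁).real (openConnIn HS 0 x ∩ (armH r ∩ S)) +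
          ((box 3 r).card : ℝ) * (μ₁).real Sᶜ := by
        rw [Finset.sum_add_distrib, Finset.sum_const, nsmul_eq_mul]
    _ ≤ t₀ * M * (μ₁).real (armH r ∩ S) + ((box 3 r).card : ℝ) * (Real.exp (3 / 2) * L⁻¹) := by
        gcongr
    _ ≤ t₀ * M * (μ₁).real (armH r) + Real.exp (3 / 2) * (μ₁).real (armH r) := by
        refine add_le_add ?_ (hgeom.trans ?_)
        · exact mul_le_mul_of_nonneg_left
            (measureReal_mono Set.inter_subset_left (measure_ne_top _ _))
            (mul_nonneg (by linarith) hM.le)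
        · exact mul_le_mul_of_nonneg_left harm (Real.exp_pos _).le
    _ = (2 * Real.log (15876 * (r : ℝ) ^ 5) * M + Real.exp (3 / 2)) * (μ₁).real (armH r) := by
        rw [ht₀, hL]; ring

/-! ### B♯ ⇒ B up to `log r` (registered exponent `11/4`) -/

/-- **B♯ ⇒ B up to a logarithm.**  Under the registered stub `stub_noFatHalfBox` (B♯, verbatim as the
hypothesis), the route's crux B `TallClusterMassBound` holds with an extra factor `1 + log r`:
`Σ_{x ∈ B_r} P_{p_c}(0 ↔_ℍ x, arm_ℍ(0,r)) ≤ C r^{11/4} (1 + log r) P_{p_c}(arm_ℍ(0,r))` for all `r ≥ 1`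
(tail from Hutchcroft's universal tightness, `DilutionToolkit.tail`; truncation `mass_le_of_tail`). -/
theorem tallClusterMassBound_log_of_noFatHalfBox
    (hB : ∃ C : ℝ, 0 < C ∧ ∀ x ∈ insert (0 : Site 3) ({Pi.single 1 1, Pi.single 1 (-1), Pi.single 2 1, Pi.single 2 (-1)} : Finset (Site 3)), ∀ n : ℕ, 1 ≤ n →
      (floorDilutedPercolation 3 (criticalProbI 3) 1).real
        {ω | C * (n : ℝ) ^ ((11 : ℝ) / 4) ≤ (clusterMaxIn (((box 3 n).image fun y : Site 3 => x + y).filter fun z : Site 3 => 0 ≤ z 0) ω : ℝ)}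
          ≤ Real.exp (-1)) :
    ∃ C : ℝ, ∀ r : ℕ, 1 ≤ r →
      ∑ x ∈ box 3 r, (μc).real (openConnIn {x : Site 3 | 0 ≤ x 0} 0 x ∩
          {ω | ∃ y : Site 3, (∃ i : Fin 3, (r : ℤ) ≤ |y i|) ∧ ω ∈ openConnIn {x : Site 3 | 0 ≤ x 0} 0 y}) ≤
        C * (r : ℝ) ^ ((11 : ℝ) / 4) * (1 + Real.log r) *
          (μc).real {ω | ∃ y : Site 3, (∃ i : Fin 3, (r : ℤ) ≤ |y i|) ∧ ω ∈ openConnIn {x : Site 3 | 0 ≤ x 0} 0 y} := by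
  obtain ⟨Cb, hCb, hfat⟩ := hB
  refine ⟨20 * (Cb + 1) + Real.exp (3 / 2), fun r hr => ?_⟩
  have htail : ∀ t : ℝ, 1 ≤ t →
      (μ₁).real {ω | t * ((Cb + 1) * (r : ℝ) ^ ((11 : ℝ) / 4)) ≤ 𝑵⟦r, ω⟧} ≤
        Real.exp (3 / 2) * Real.exp (-t / 2) := by
    intro t ht
    have h := DilutionToolkit.tail Cb hCb hfat 1 0 (Finset.mem_insert_self _ _) r hr t ht
    refine le_trans (le_of_eq ?_) h
    congr 1
    ext ω
    simp only [Set.mem_setOf_eq, ncard_eq_mass]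
  have hM : 0 < (Cb + 1) * (r : ℝ) ^ ((11 : ℝ) / 4) := by positivity
  have h := mass_le_of_tail hr hM htail
  change ∑ x ∈ box 3 r, (μc).real (openConnIn HS 0 x ∩ armH r) ≤ _ * (μc).real (armH r)
  refine h.trans (mul_le_mul_of_nonneg_right ?_ measureReal_nonneg)
  have hr1 : (1 : ℝ) ≤ r := by exact_mod_cast hr
  have hlog := log_scale_le hr
  have hlr : 0 ≤ Real.log r := Real.log_nonneg hr1
  have hR : 1 ≤ (r : ℝ) ^ ((11 : ℝ) / 4) := Real.one_le_rpow hr1 (by norm_num)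
  have hC1 : 0 ≤ Cb + 1 := by linarith
  have hE : 0 < Real.exp (3 / 2) := Real.exp_pos _
  calc 2 * Real.log (15876 * (r : ℝ) ^ 5) * ((Cb + 1) * (r : ℝ) ^ ((11 : ℝ) / 4)) + Real.exp (3 / 2)
      ≤ 2 * (10 + 5 * Real.log r) * ((Cb + 1) * (r : ℝ) ^ ((11 : ℝ) / 4)) + Real.exp (3 / 2) := by
        gcongr
    _ ≤ 20 * (1 + Real.log r) * ((Cb + 1) * (r : ℝ) ^ ((11 : ℝ) / 4)) +
          Real.exp (3 / 2) * ((r : ℝ) ^ ((11 : ℝ) / 4) * (1 + Real.log r)) := by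
        refine add_le_add (mul_le_mul_of_nonneg_right (by linarith) (by positivity)) ?_
        exact le_mul_of_one_le_right hE.le (by nlinarith)
    _ = (20 * (Cb + 1) + Real.exp (3 / 2)) * (r : ℝ) ^ ((11 : ℝ) / 4) * (1 + Real.log r) := by ring

/-! ### Registered wrappers (def-free signatures, registered on the crux item) -/

/-- **Registered wrapper `stub_sharpDominatesBLog`**: (B♯, the registered `stub_noFatHalfBox` verbatim)
→ the route's B with a factor `1 + log r`; verbatim `tallClusterMassBound_log_of_noFatHalfBox`. -/
theorem stub_sharpDominatesBLog : (∃ C : ℝ, 0 < C ∧ ∀ x ∈ insert (0 : Site 3) ({Pi.single 1 1, Pi.single 1 (-1), Pi.single 2 1, Pi.single 2 (-1)} : Finset (Site 3)), ∀ n : ℕ, 1 ≤ n → (floorDilutedPercolation 3 (criticalProbI 3) 1).real {ω | C * (n : ℝ) ^ ((11 : ℝ) / 4) ≤ (clusterMaxIn (((box 3 n).image fun y : Site 3 => x + y).filter fun z : Site 3 => 0 ≤ z 0) ω : ℝ)} ≤ Real.exp (-1)) → ∃ C : ℝ, ∀ r : ℕ, 1 ≤ r → ∑ x ∈ box 3 r,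 (bondPercolation (zdGraph 3) (criticalProbI 3)).real (openConnIn {x : Site 3 | 0 ≤ x 0} 0 x ∩ {ω | ∃ y : Site 3, (∃ i : Fin 3, (r : ℤ) ≤ |y i|) ∧ ω ∈ openConnIn {x : Site 3 | 0 ≤ x 0} 0 y}) ≤ C * (r : ℝ) ^ ((11 : ℝ) / 4) * (1 + Real.log r) * (bondPercolation (zdGraph 3) (criticalProbI 3)).real {ω | ∃ y : Site 3, (∃ i : Fin 3, (r : ℤ) ≤ |y i|) ∧ ω ∈ openConnIn {x : Site 3 | 0 ≤ x 0} 0 y} :=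
  tallClusterMassBound_log_of_noFatHalfBox

end Summit.CriticalPhenomena.PercolationContinuityZ3.Theorems.FloorRusso.Dominates

end
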